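import Literature.MathematicalPhysics.QuantumFieldTheory.Balaban1983to89.B13WindowKernels
import Literature.MathematicalPhysics.QuantumFieldTheory.Balaban1983to89.NodeOLettersOfWalksAcross

/-!
# `Balaban1983to89.B13TermWalksPullback` — THE W-WALKS RUNG OF RECORD TRANSPORTS ALONG PULLBACKS AND PLACEMENTS:
# `TermWalks` on the window space ⟹ `TermWalks` for the pullback term (same package); a family PRESENTED by pullbacks ∕
# placements of window data carrying ONE package satisfies `UniformWalksAcross`, hence NODE O's binder, by name

statement-level bookkeeping over published theorems with citation tags; kernel-checked compositions of tree theorems;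
nothing here is a claim about the Yang–Mills mass gap.

Cell pub-balaban, BINDER row (D4) (`RemainderConst` leaves for Bałaban's split), owner lineage b2b-balaban-beta-an4
(gen 120).  WHY.  The (B1) input OF RECORD for NODE O's binder `B13TermWalkDataOneTorus.ExistsUniformAcrossSmall` (:353)
is, since `NodeOLettersOfWalksAcross` (cell pub-ymgap, N10), the W-walks rung: per term `TermWalks 𝒦 q` (joint walk
expansions of the local factor `L`, the full precision `P` and the term precision `A2` in the shape of
[Balaban1985BackgroundPropagators] Thm 3.10, two accretivities, five volume sums, far-ness; sixteen constants `q`), across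
a family `UniformWalksAcross 𝓣 q`, and `acrossSmall_of_walks : UniformWalksAcross 𝓣 q ⟹ … ⟹ ExistsUniformAcrossSmall`.
This lineage's `B13TermKernelsPullback` ∕ `B13WindowKernels` transport the OLDER per-term statement (v)
(`B13TermWalkData.TermWalkData`, `termWalkData_pullback`, `termWalkData_place`) but not the rung of record.  Print's
locality ([Balaban1987RG1] (1.7) p. 261 *"the term corresponding to a domain X depends on U_j restricted to X"*;
[Balaban1985BackgroundPropagators] Thm 3.10 p. 416 *"A term in this expansion, corresponding to a walk ω, depends on
configuration U restricted to X̃₀⁵ ∪ … ∪ X̃ₙ⁵"*) says the term kernels of record ARE pullbacks of window-space data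
along the restriction map; a producer of the rung's hypothesis for such a family supplies the W-walks datum ON THE
WINDOW SPACE.  This file is the missing composition.
* §1 `termWalks_pullback` — `TermWalks 𝒦 q` on `V` and `r : W →L[ℂ] V` mapping the `R′`-ball into the `q.R`-ball give
  `TermWalks (pullback 𝒦 r) {q with R := R′}`: the product reading `G2 = L·P^{−1/2}` is read at `r u`, the three joint
  walk expansions compose with `r` (`B13TermKernelsPullback.jointWalkExpansion_comp_clm`), the two accretivities are read
  at `r u ∈ ball 0 q.R`, the five volume sums and far-ness are configuration-free; `termWalks_pullback_of_opNorm_le`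
  (contraction: SAME package); `termWalks_place` (a placed window object: datum at the window placement ⟹ datum at the
  placement, `B13WindowKernels.place_eq_pullback`).  The extra-column instances of the pullback are those of `𝒦`
  (passed explicitly: `pullback` is data, not an `abbrev`).
* §2 `uniformWalksAcross_of_pullbacks` — a family `𝓣 : S → TorusTerms c d` each of whose term kernels IS (`=`) the
  pullback of some window-space kernel data along a contraction, the window data carrying `TermWalks · q` with ONE
  package `q`, satisfies `UniformWalksAcross 𝓣 q`; `uniformWalksAcross_of_placements` (the same for placed window
  objects, data at the window placements); `acrossSmall_of_pullbacks` ∕ `acrossSmall_of_placements` — NODE O's binder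
  (:353) for such families from the window-space data, an admissible package, any rate book with `0 < κ_C ≤ ρ′` and the
  exchange inequality, BY NAME through `NodeOLettersOfWalksAcross.acrossSmall_of_walks`.
CHAIN (by name): window-space `TermWalks` per term ⟹ (§1) `TermWalks` per pullback term ⟹ (§2) `UniformWalksAcross 𝓣 q`
⟹ `acrossSmall_of_walks` ⟹ `ExistsUniformAcrossSmall 𝓣 α R_σ0 θ₀` ⟹ `B13TermWalkDataOneTorus` ∕ `NodeOLetters` downstream.

HONEST FRAMING: [folklore] compositions of tree theorems; NOTHING of Bałaban's operators is constructed; that HIS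
`C*Δ_k(σ)C_{Z₀ᶜ}`, `C*Δ_k(σ,𝐔,𝐉)C`, `Δ^{(k)}(Z₀,σ)` at a domain are window objects carrying ONE W-walks package at
complex backgrounds, uniformly in scale, history and torus, is the OBJECT-level content of [Balaban1985BackgroundPropagators]
Thm 3.10 ∕ (3.154), [Balaban1988RG2Cluster] p. 13, p. 15 (cell GAPS G-B9-10; NODE O ∕ NODE 00) — the HYPOTHESIS of every
theorem here, not an output; the torus-metric clauses (walk majorants in `tdist1`, volume sums, far-ness) are per torus
as in print.  Row (D4) instance 0∕1 and T⁴ spine 0∕9 UNCHANGED; NOT NODE O for Bałaban's family, NOT [B12] Thm 2, NOT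
`BetaPertH`, NOT continuum, NOT mass gap, NOT Clay.  No `sorry`, no named fact, no `def`, no instance, no notation;
standard axioms.  HONEST DEPENDENCY (cell pub-balaban, verbatim): continuum YM on T⁴ ⇐ BetaPertH ∧ nine spine estimates
(0∕9 proved); BetaPertH ⇐ (D1) ∧ (D4) ∧ CAP+tail.
-/

noncomputable section

namespace Literature.MathematicalPhysics.QuantumFieldTheory.Balaban1983to89.B13TermWalksPullback

open Metric Set
open B13TermWalkData (TermKernels TorusTerms)
open B13TermWalkDataOneTorus (ExistsUniformAcrossSmall)
open B13TermKernelsPullback (pullback mapsTo_ball_of_opNorm_le jointWalkExpansion_comp_clm)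
open B13WindowKernels (WindowKernels Placement place place_eq_pullback)
open NodeOLettersOfWalksAcross (WalkPackage RateBook TermWalks UniformWalksAcross acrossSmall_of_walks)

variable {c : B13.Consts} {d N' ν : ℕ} {Nf : Fin ν → ℕ} [∀ i, NeZero (Nf i)]
variable {W V : Type*} [NormedAddCommGroup W] [NormedSpace ℂ W] [NormedAddCommGroup V] [NormedSpace ℂ V]

/-! ## §1 One term: the W-walks datum pulls back along a restriction, and transports to a placement -/

section OneTerm

/-- **THE W-WALKS DATUM OF A TERM PULLS BACK ALONG A RESTRICTION.**  If the kernel data `𝒦` of a term on the window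
space `V` carry `TermWalks 𝒦 q` and `r : W →L[ℂ] V` maps the `R′`-ball of `W` into the `q.R`-ball of `V`, then the
pullback term `pullback 𝒦 r` (`A(σ,u) := A_V(σ, r u)`, `G(σ,u) := G_V(σ, r u)`) carries `TermWalks` with the package
`{q with R := R′}`: the product reading `G = L·P^{−1/2}` is read at `r u`; the joint walk expansions of `L`, `P`, `A2`
compose with `r` (same walks, amplitudes, distances, rates, constants); the `m`- and `m_A`-accretivities are read at
`r u ∈ ball 0 q.R`; volume sums and far-ness do not see the configuration.  The extra-column instances are those of `𝒦`.
[cite: Balaban1985BackgroundPropagators, Thm 3.10 p.416, (3.154) p.427; Balaban1988RG2Cluster, (2.7) p.13, p.15, (2.14)–(2.16) pp.15–16; Balaban1987RG1, (1.7) p.261] -/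
theorem termWalks_pullback {𝒦 : TermKernels c d N' ν Nf V} [hF : Fintype 𝒦.C₀] [hD : DecidableEq 𝒦.C₀]
    {q : WalkPackage} (h : TermWalks 𝒦 q) (r : W →L[ℂ] V) {R' : ℝ}
    (hr : MapsTo r (ball (0 : W) R') (ball (0 : V) q.R)) :
    letI : Fintype (pullback 𝒦 r).C₀ := hF
    letI : DecidableEq (pullback 𝒦 r).C₀ := hD
    TermWalks (pullback 𝒦 r) { q with R := R' } := by
  letI : Fintype (pullback 𝒦 r).C₀ := hF
  letI : DecidableEq (pullback 𝒦 r).C₀ := hD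
  obtain ⟨L, P, hG2, ⟨WL, TL, SXL, AL, DL, ρwL, hJL⟩, ⟨WP, TP, SXP, AP, DP, ρwP, hJP⟩, hPacc⟩ := h.product
  obtain ⟨WA, TA, SXA, AA, DA, ρwA, hJA⟩ := h.precision
  exact
    { nonempty := h.nonempty
      product := ⟨fun σ u => L σ (r u), fun σ u => P σ (r u), fun σ u => hG2 σ (r u),
        ⟨WL, fun ω σ u => TL ω σ (r u), SXL, AL, DL, ρwL, jointWalkExpansion_comp_clm hJL r hr⟩,
        ⟨WP, fun ω σ u => TP ω σ (r u), SXP, AP, DP, ρwP, jointWalkExpansion_comp_clm hJP r hr⟩,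
        fun σ hσ u hu v => hPacc σ hσ (r u) (hr hu) v⟩
      precision := ⟨WA, fun ω σ u => TA ω σ (r u), SXA, AA, DA, ρwA, jointWalkExpansion_comp_clm hJA r hr⟩
      accA := fun σ hσ u hu v => h.accA σ hσ (r u) (hr hu) v
      volN₀ := h.volN₀
      volN := h.volN
      volN' := h.volN'
      volΛN := h.volΛN
      volΛ := h.volΛ
      far := h.far }

/-- **Along a contraction the package is unchanged**: `TermWalks 𝒦 q ⟹ TermWalks (pullback 𝒦 r) q` for `‖r‖ ≤ 1`
(coordinate restrictions in sup norms are contractions — the printed case). [cite: Balaban1985BackgroundPropagators, Thm 3.10 p.416; Balaban1988RG2Cluster, p.13, p.15; Balaban1987RG1, (1.7) p.261] -/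
theorem termWalks_pullback_of_opNorm_le {𝒦 : TermKernels c d N' ν Nf V} [hF : Fintype 𝒦.C₀] [hD : DecidableEq 𝒦.C₀]
    {q : WalkPackage} (h : TermWalks 𝒦 q) (r : W →L[ℂ] V) (hr : ‖r‖ ≤ 1) :
    letI : Fintype (pullback 𝒦 r).C₀ := hF
    letI : DecidableEq (pullback 𝒦 r).C₀ := hD
    TermWalks (pullback 𝒦 r) q :=
  termWalks_pullback h r (mapsTo_ball_of_opNorm_le r hr le_rfl)

variable {J : Type}

/-- **A PLACED WINDOW OBJECT: the W-walks datum at the window placement (the torus's bookkeeping with `r = id`)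
transports to the placement along its restriction, SAME package** (`‖P.r‖ ≤ 1`; `place c 𝒲 P = pullback (place c 𝒲
P.window) P.r` by `rfl`). [cite: Balaban1987RG1, (1.7) p.261, (1.21) p.264; Balaban1988RG2Cluster, p.13, p.15; Balaban1985BackgroundPropagators, Thm 3.10 p.416] -/
theorem termWalks_place {𝒲 : WindowKernels J V} [hF : Fintype 𝒲.C₀] [hD : DecidableEq 𝒲.C₀]
    {P : Placement 𝒲 d N' ν Nf W} {q : WalkPackage}
    (h : letI : Fintype (place c 𝒲 P.window).C₀ := hF; letI : DecidableEq (place c 𝒲 P.window).C₀ := hD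
      TermWalks (place c 𝒲 P.window) q)
    (hr : ‖P.r‖ ≤ 1) :
    letI : Fintype (place c 𝒲 P).C₀ := hF
    letI : DecidableEq (place c 𝒲 P).C₀ := hD
    TermWalks (place c 𝒲 P) q :=
  -- `place c 𝒲 P = pullback (place c 𝒲 P.window) P.r` definitionally (`place_eq_pullback` is `rfl`)
  termWalks_pullback_of_opNorm_le (𝒦 := place c 𝒲 P.window) (hF := hF) (hD := hD) h P.r hr

end OneTerm

/-! ## §2 Across a family presented by pullbacks ∕ placements: `UniformWalksAcross`, and NODE O's binder by name -/

section Across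

/-- **A FAMILY PRESENTED BY PULLBACKS OF WINDOW DATA WITH ONE PACKAGE SATISFIES THE RUNG.**  If every term kernel of
every member `𝓣 s` IS the pullback `pullback 𝒦V r` of kernel data `𝒦V` on some window space along a contraction
`r`, and the window data carry `TermWalks 𝒦V q` with ONE package `q` (independent of member and term), then
`UniformWalksAcross 𝓣 q`.  For Bałaban's family the hypothesis is NODE O ∕ NODE 00 content (the term tower of record
presented by restrictions, [I] (1.7), with [B9]-Thm-3.10 expansions uniform in scale, history and torus) — NOT
supplied. [cite: Balaban1987RG1, (1.7) p.261, (1.21) p.264; Balaban1988RG2Cluster, p.13, p.15, (2.14)–(2.16) pp.15–16; Balaban1985BackgroundPropagators, Thm 3.10 p.416, (3.154) p.427] -/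
theorem uniformWalksAcross_of_pullbacks {S : Type*} {𝓣 : S → TorusTerms c d} {q : WalkPackage}
    (h : ∀ s, ∀ i : (𝓣 s).ι, ∃ (V : Type) (_ : NormedAddCommGroup V) (_ : NormedSpace ℂ V)
      (𝒦V : TermKernels c d (𝓣 s).N' (𝓣 s).ν (𝓣 s).Nf V) (_ : Fintype 𝒦V.C₀) (_ : DecidableEq 𝒦V.C₀)
      (r : (𝓣 s).E →L[ℂ] V), ‖r‖ ≤ 1 ∧ TermWalks 𝒦V q ∧ (𝓣 s).𝒦 i = pullback 𝒦V r) :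
    UniformWalksAcross 𝓣 q := by
  intro s i
  obtain ⟨V, _, _, 𝒦V, hF, hD, r, hr, hw, heq⟩ := h s i
  rw [heq]
  exact ⟨hF, hD, termWalks_pullback_of_opNorm_le hw r hr⟩

/-- **A FAMILY OF PLACED WINDOW OBJECTS WITH ONE PACKAGE SATISFIES THE RUNG**: every term kernel of every member IS
`place c 𝒲 P` for a window object `𝒲` and a placement `P` with `‖P.r‖ ≤ 1`, the W-walks datum holding at the window
placement with ONE package `q` ⟹ `UniformWalksAcross 𝓣 q`. [cite: Balaban1987RG1, (1.7) p.261, (1.21) p.264; Balaban1988RG2Cluster, p.13, p.15; Balaban1985BackgroundPropagators, Thm 3.10 p.416] -/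
theorem uniformWalksAcross_of_placements {S : Type*} {𝓣 : S → TorusTerms c d} {q : WalkPackage}
    (h : ∀ s, ∀ i : (𝓣 s).ι, ∃ (J V : Type) (_ : NormedAddCommGroup V) (_ : NormedSpace ℂ V)
      (𝒲 : WindowKernels J V) (hF : Fintype 𝒲.C₀) (hD : DecidableEq 𝒲.C₀)
      (P : Placement 𝒲 d (𝓣 s).N' (𝓣 s).ν (𝓣 s).Nf (𝓣 s).E),
      ‖P.r‖ ≤ 1 ∧
        (letI : Fintype (place c 𝒲 P.window).C₀ := hF; letI : DecidableEq (place c 𝒲 P.window).C₀ := hD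
          TermWalks (place c 𝒲 P.window) q) ∧
        (𝓣 s).𝒦 i = place c 𝒲 P) :
    UniformWalksAcross 𝓣 q := by
  intro s i
  obtain ⟨J, V, _, _, 𝒲, hF, hD, P, hr, hw, heq⟩ := h s i
  rw [heq]
  exact ⟨hF, hD, termWalks_place (hF := hF) (hD := hD) hw hr⟩

/-- **NODE O's BINDER (:353) FOR A FAMILY PRESENTED BY PULLBACKS, FROM WINDOW-SPACE W-WALKS DATA** — by name through
`NodeOLettersOfWalksAcross.acrossSmall_of_walks`: the presentation hypothesis of `uniformWalksAcross_of_pullbacks`, an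
admissible package, any rate book with `0 < κ_C ≤ ρ′`, `0 ≤ α < R`, `R_σ0 ≤ R_σ` and the exchange inequality
`2K̄(e^{−(ρ′−κ_C)R_σ} + α/R) ≤ θ₀` give `ExistsUniformAcrossSmall 𝓣 α R_σ0 θ₀`. [cite: Balaban1988RG2Cluster, (1.11) p.5, p.13, p.15, (2.16) p.16; Balaban1985BackgroundPropagators, Thm 3.10 p.416; Balaban1987RG1, (1.7) p.261] -/
theorem acrossSmall_of_pullbacks {S : Type*} {𝓣 : S → TorusTerms c d} {q : WalkPackage}
    (h : ∀ s, ∀ i : (𝓣 s).ι, ∃ (V : Type) (_ : NormedAddCommGroup V) (_ : NormedSpace ℂ V)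
      (𝒦V : TermKernels c d (𝓣 s).N' (𝓣 s).ν (𝓣 s).Nf V) (_ : Fintype 𝒦V.C₀) (_ : DecidableEq 𝒦V.C₀)
      (r : (𝓣 s).E →L[ℂ] V), ‖r‖ ≤ 1 ∧ TermWalks 𝒦V q ∧ (𝓣 s).𝒦 i = pullback 𝒦V r)
    (hq : q.Admissible) (rb : RateBook q) {α Rσ₀ θ₀ : ℝ} (hα : 0 ≤ α) (hαR : α < q.R) (hRσ : Rσ₀ ≤ q.Rσ)
    (hκCpos : 0 < rb.κC) (hκCρ : rb.κC ≤ rb.ρ')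
    (hθ : 2 * q.Kbar * (Real.exp (-((rb.ρ' - rb.κC) * q.Rσ)) + α / q.R) ≤ θ₀) :
    ExistsUniformAcrossSmall 𝓣 α Rσ₀ θ₀ :=
  acrossSmall_of_walks (uniformWalksAcross_of_pullbacks h) hq rb hα hαR hRσ hκCpos hκCρ hθ

/-- **NODE O's BINDER (:353) FOR A FAMILY OF PLACED WINDOW OBJECTS**, from the W-walks data at the window placements
with ONE package — by name. [cite: Balaban1988RG2Cluster, (1.11) p.5, p.13, p.15, (2.16) p.16; Balaban1985BackgroundPropagators, Thm 3.10 p.416; Balaban1987RG1, (1.7) p.261, (1.21) p.264] -/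
theorem acrossSmall_of_placements {S : Type*} {𝓣 : S → TorusTerms c d} {q : WalkPackage}
    (h : ∀ s, ∀ i : (𝓣 s).ι, ∃ (J V : Type) (_ : NormedAddCommGroup V) (_ : NormedSpace ℂ V)
      (𝒲 : WindowKernels J V) (hF : Fintype 𝒲.C₀) (hD : DecidableEq 𝒲.C₀)
      (P : Placement 𝒲 d (𝓣 s).N' (𝓣 s).ν (𝓣 s).Nf (𝓣 s).E),
      ‖P.r‖ ≤ 1 ∧
        (letI : Fintype (place c 𝒲 P.window).C₀ := hF; letI : DecidableEq (place c 𝒲 P.window).C₀ := hD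
          TermWalks (place c 𝒲 P.window) q) ∧
        (𝓣 s).𝒦 i = place c 𝒲 P)
    (hq : q.Admissible) (rb : RateBook q) {α Rσ₀ θ₀ : ℝ} (hα : 0 ≤ α) (hαR : α < q.R) (hRσ : Rσ₀ ≤ q.Rσ)
    (hκCpos : 0 < rb.κC) (hκCρ : rb.κC ≤ rb.ρ')
    (hθ : 2 * q.Kbar * (Real.exp (-((rb.ρ' - rb.κC) * q.Rσ)) + α / q.R) ≤ θ₀) :
    ExistsUniformAcrossSmall 𝓣 α Rσ₀ θ₀ :=
  acrossSmall_of_walks (uniformWalksAcross_of_placements h) hq rb hα hαR hRσ hκCpos hκCρ hθ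

end Across

end Literature.MathematicalPhysics.QuantumFieldTheory.Balaban1983to89.B13TermWalksPullback

end
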